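import Summits.RiemannHypothesis.RiemannHypothesis.Theses.RobinFullPortrait
import Literature.Algebra.Polynomial.NonzeroPreservation
import HarnessLib

/-!
# `RobinFullPortrait.Assembly` (item stmt-RiemannHypothesis-24273) — L50 «ROBIN · 26-FULL PORTRAIT», the portrait

Port (verbatim proof bodies) of `assembly_holds` and its two lemmas from planner rh-idea-4 g2's kernel-checked
route sketch `pub/ideators/rh-idea-4/l50/Sketch.lean` (sha16 15b0019a3d27a5cb): from the analytic leg
(`AnalyticLegTwentySix`, the Solé–Planat primorial inequality at `t = 26` for primes `q ≥ 2^61 − 1`) and the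
range leg (`RangeLeg`), the PORTRAIT of a least Robin counterexample `N > 5040`: it is superabundant
(Akbary–Friggstad 2009 Thm 3, tree `AkbaryFriggstad2009_thm3`), divisible by `2^26` (a superabundant number is
Hardy–Ramanujan; a non-26-free Hardy–Ramanujan number is divisible by `2^26`; 26-free is excluded by the tree's
`RobinTFree.robinInequality_of_tFree_of_primorial_bound` fed with the two legs), and
`log N > 0.99947·(10¹⁹ − 1)` (tree rows `RobinFiniteC1.robinCA_below_high_18200000000` +
`robin_all_of_robinCA_below_low`).  One typer delta vs the Sketch: the primality of `2^61 − 1` is CITED from the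
tree (`Literature.Algebra.Polynomial.NonzeroPreservation.prime_2305843009213693951`, Lucas–Lehmer) instead of
re-running Lucas–Lehmer here (dedup).
Label of record (director-rh g12 (Z1)/(Z3)): «(record) L50 assembly; category (b) RECORD, 0 toward RH».
Cell rh-split, typer-3 g3 filing.  Nothing here bears on the truth of RH.
-/

set_option linter.dupNamespace false  -- the mandated namespace repeats `RiemannHypothesis`

namespace Summit.RiemannHypothesis.RiemannHypothesis.Theorems.RobinFullPortrait

open Literature.NumberTheory.LFunctions Literature.NumberTheory.DiophantineGeometry
open Summit.RiemannHypothesis.RiemannHypothesis.Theorems.Splittings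

/-- A superabundant number is a Hardy–Ramanujan integer (Alaoglu–Erdős 1944 Thm 1, via CLMS 2007 Lemma 9 =
tree `exists_hardyRamanujan_le`). [folklore] -/
theorem isHardyRamanujan_of_superabundant {n : ℕ} (h : Nat.Superabundant n) : IsHardyRamanujan n := by
  have hn1 : 1 ≤ n := h.one_le
  obtain ⟨m, hm0, hmn, hmH, hσ⟩ := exists_hardyRamanujan_le n (by omega)
  rcases hmn.lt_or_eq with hlt | rfl
  · exfalso
    have hlt' := h.lt (Nat.one_le_iff_ne_zero.mpr hm0) hlt
    have hmR : (0 : ℝ) < m := by exact_mod_cast Nat.pos_of_ne_zero hm0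
    have hnR : (0 : ℝ) < n := by exact_mod_cast hn1
    have hσR : (ArithmeticFunction.sigma 1 n : ℝ) * m ≤ (ArithmeticFunction.sigma 1 m : ℝ) * n := by
      exact_mod_cast hσ
    have hle : (ArithmeticFunction.sigma 1 n : ℝ) / n ≤ (ArithmeticFunction.sigma 1 m : ℝ) / m := by
      rw [div_le_div_iff₀ hnR hmR]; linarith
    linarith
  · exact hmH

/-- A Hardy–Ramanujan integer that is not `t`-free is divisible by `2^t` (exponents are non-increasing).
[folklore] -/
theorem two_pow_dvd_of_not_tFree {t n : ℕ} (hH : IsHardyRamanujan n) (h : ¬ TFree t n) : 2 ^ t ∣ n := by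
  simp only [TFree, not_forall, not_not] at h
  obtain ⟨p, hp, hdvd⟩ := h
  have hn0 : n ≠ 0 := hH.1
  have hle : t ≤ n.factorization p := (hp.pow_dvd_iff_le_factorization hn0).1 hdvd
  rcases hp.two_le.eq_or_lt with h2 | h2
  · rw [h2]; exact hdvd
  · exact (Nat.prime_two.pow_dvd_iff_le_factorization hn0).2 (hle.trans (hH.2 2 p Nat.prime_two hp h2))

/-- **`Assembly` (item stmt-RiemannHypothesis-24273) holds**: the portrait of a least Robin counterexample from
the two legs — superabundant, `2^26 ∣ N`, `log N > 0.99947·(10¹⁹ − 1)`. [folklore] -/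
theorem assembly_proof : Summit.RiemannHypothesis.RiemannHypothesis.Theses.RobinFullPortrait.Assembly := by
  intro hL hR hB hK hRH N hN
  have hSA : Nat.Superabundant N := AkbaryFriggstad2009_thm3 hN
  obtain ⟨⟨h5040, hfail⟩, _hmin⟩ := hN
  refine ⟨hSA, ?_, ?_⟩
  · have hnot : ¬ TFree 26 N := fun hfree => hfail
      (RobinTFree.robinInequality_of_tFree_of_primorial_bound (t := 26) (by norm_num)
        Literature.Algebra.Polynomial.NonzeroPreservation.prime_2305843009213693951
        (hL hB hK) (hR hB hK hRH) N h5040 hfree)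
    exact two_pow_dvd_of_not_tFree (isHardyRamanujan_of_superabundant hSA) hnot
  · by_contra hle
    push Not at hle
    have hTop : robinCA_below (10 ^ 19 + 1) :=
      RobinFiniteC1.robinCA_below_high_18200000000 hB hK le_rfl hRH
    refine hfail (RobinFiniteC1.robin_all_of_robinCA_below_low hB hK hTop (by norm_num) N h5040 ?_)
    have e : (((10 ^ 19 : ℕ) : ℝ) - 1) = (10 : ℝ) ^ 19 - 1 := by push_cast; ring
    rw [e]; exact hle

end Summit.RiemannHypothesis.RiemannHypothesis.Theorems.RobinFullPortrait
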